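import Summits.RiemannHypothesis.RiemannHypothesis.Theorems.PfPersistenceTwoParityIndexFamilies
import HarnessLib

/-!
# PF-persistence, cand-7 seat (pub-rhpf, gen 5), two-parity index ladder, part 3/3: the level hierarchy of the
# FULL real Weil form — the THIRD level is exactly `K ≤ 1` (strictly weaker than RH, witnessed)

pub-rhpf cell, candidate seat 7 (floating B), generation 5.  HONEST FRAMING (page 1 of everything in this
cell): a long-odds MECHANISM / RIGIDITY SEARCH around Weil's quadratic functional; NOTHING here claims,
approaches or conditionally proves RH.  Labels: PROVED = kernel-checked (this file, RH-free throughout);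
CITED = in print (E. Bombieri, *Remarks on Weil's quadratic functional in the theory of prime numbers I*,
Rend. Mat. Acc. Lincei (9) 11 (2000), Thm 8: the full form has one negative eigenvalue per off-line zero `γ` with
`Im γ > 0`, i.e. `2K` for `ζ`; Thm 9: `K` in EACH parity sector [Bombieri2000Weil]; H. Yoshida, Invent. Math. 110
(1992), Prop. 1 [Yoshida1992HermitianForms]); HYPOTHESIS = an explicit binder.

Notation: `Q = weilQuadratic` (untruncated), `ĝ = weilMellin g`, `𝒬 = {ρ : ζ(ρ) = 0 non-trivial, Re ρ > 1/2,
Im ρ > 0}` (quadrant representatives of off-line quadruples), `K = #𝒬`.  The M2 seat's packet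
(`PfPersistenceM2EvenSectorIndexBound/Lower/Exact`, `PfPersistenceM2RealSectorSecondLevel`) proved: EVEN negative
index on long windows `= K` (for `K < ∞`), the second EVEN level `⟺ K ≤ 1`, and levels 1 and 2 of the FULL REAL
form are RH-equivalent.  Its named residue (HOME/M2-ROUTE.md §11): the ODD halves and the full-form levels `≥ 3` —
supplied by this seat's three-part packet `PfPersistenceTwoParityIndexBound` (odd `≤ K`, real `≤ 2K`),
`PfPersistenceTwoParityIndexFamilies` (index language, appending parity families, lower halves) and
`PfPersistenceTwoParityIndexLevels` (the level hierarchy of the full real form; third level `⟺ K ≤ 1`).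

PROVED in this part (all RH-free): **third level** — under `K < ∞`, `(∀ a, ¬ RealNegIndexAtLeast 3 a) ↔ K ≤ 1`
(`not_realNegIndexAtLeast_three_iff`); unconditionally `→ 𝒬 infinite ∨ 𝒬.encard ≤ 1`
(`quadrant_infinite_or_encard_le_one_of_realThird`) and `← 𝒬.encard ≤ 1`
(`not_realNegIndexAtLeast_three_of_encard_le_one`); with EXACTLY one off-line quadruple the third real level is clean
at every window while RH fails and the SECOND real level is not (`realThird_clean_of_card_eq_one`) — so the third
level of the full form is STRICTLY WEAKER than RH, of exact strength `K ≤ 1` (levels 1, 2 are RH by the M2 packet);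
`¬RH ↔ 1 ≤ K` (`K < ∞`); general level: `2·𝒬.encard ≤ n →` level `n + 1` clean (part 2), and level `n + 1` clean
`→ K = 0 ∨ K + 1 ≤ n` (`card_eq_zero_or_succ_le_of_not_realNegIndexAtLeast_succ`); the exact threshold `2K ≤ n`
PROVED CONDITIONALLY on the typed odd "≥" half `OddIndexLowerHalf` (HYPOTHESIS binder; CITED shape Bombieri 2000
Thm 9 odd part; candidate part 4 of this seat): `exists_realNegIndexAtLeast_iff_of_oddLowerHalf`,
`not_realNegIndexAtLeast_succ_iff_of_oddLowerHalf` — only levels 1, 2 of the full form are RH-strength.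

DATA companion (harness, not Lean): the cell's two-parity Galerkin census C7-N2 (|n₋(even) − n₋(odd)| ≤ 1 on every
served window; a planted single quadruple reads (1,1)) is the finite-window shadow of this ladder; harness candidate
`cand7-015` (third full level `≥ 0` per window) is EXPECTED to fail controls exactly on `K = 1` plants — the typed
blindness proved here.  Not touched: `K = ∞`, any FIRST-level lower bound (RH-strength), the odd "≥" half.
-/

noncomputable section

set_option linter.dupNamespace false

open Complex Filter Set MeasureTheory
open scoped Real Topology ComplexConjugate BigOperators

namespace Summit.RiemannHypothesis.RiemannHypothesis.Theorems.PfPersistenceParityIndex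

open Literature.NumberTheory.LFunctions
open Literature.NumberTheory.LFunctions.WeilConverse
open Literature.NumberTheory.LFunctions.ZetaZeros
open Summit.RiemannHypothesis.RiemannHypothesis.Theorems.PfPersistenceM2NegIndex

-- `𝒬` = the open quadrant of non-trivial zeros, `Re ρ > 1/2`, `Im ρ > 0` (one representative per off-line
-- quadruple); a NOTATION (not a definition), so every statement below is literally over the M2 seat's set.
set_option quotPrecheck false in
local notation "𝒬" => {ρ : ℂ | ρ ∈ riemannZetaNontrivialZeros ∧ 1 / 2 < ρ.re ∧ 0 < ρ.im}

/-! ## E. The level hierarchy of the FULL real form: the third level is exactly `K ≤ 1` -/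

/-- **The THIRD level of the full real Weil form, typed** (this seat's two-parity ladder at theorem level): under
finitely many off-line zeros, "no window carries THREE independent real negative directions" holds IF AND ONLY IF
there is at most ONE off-line quadruple.  (`←`: real index `≤ 2K ≤ 2`; `→`: with `K ≥ 2`, two even directions and
one odd direction.)  Contrast: levels 1 and 2 of the same form are RH-equivalent (M2,
`riemannHypothesis_iff_forall_not_realNegIndexAtLeast_two/_one`). [cite: Bombieri2000Weil, Thm 8, Thm 9] -/
theorem not_realNegIndexAtLeast_three_iff (hfin : Set.Finite 𝒬) :
    (∀ a : ℝ, ¬ RealNegIndexAtLeast 3 a) ↔ hfin.toFinset.card ≤ 1 := by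
  constructor
  · intro hno
    by_contra hlt
    obtain ⟨A, hA⟩ := realNegIndexAtLeast_succ_of_finite hfin (by omega) (n := 2) (by omega)
    exact hno A (hA A le_rfl)
  · intro hle a
    apply not_realNegIndexAtLeast_succ_of_two_mul_encard_le
    rw [hfin.encard_eq_coe_toFinset_card]
    have h2 : (2 : ℕ∞) * (hfin.toFinset.card : ℕ∞) = ((2 * hfin.toFinset.card : ℕ) : ℕ∞) := by push_cast; rfl
    rw [h2, Nat.cast_le]
    omega

/-- Unconditional reading of the third real level: no window with three real negative directions ⇒ EITHER
infinitely many quadrant zeros (the typed open residue `K = ∞`) OR at most one off-line quadruple.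
[cite: Bombieri2000Weil, Thm 11] -/
theorem quadrant_infinite_or_encard_le_one_of_realThird (hno : ∀ a : ℝ, ¬ RealNegIndexAtLeast 3 a) :
    Set.Infinite 𝒬 ∨ Set.encard 𝒬 ≤ 1 := by
  by_cases hfin : Set.Finite 𝒬
  · right
    rw [hfin.encard_eq_coe_toFinset_card]
    exact_mod_cast (not_realNegIndexAtLeast_three_iff hfin).1 hno
  · exact Or.inl hfin

/-- Conversely (RH-free, no finiteness hypothesis): at most one off-line quadruple forbids a third real negative
direction at every window. [cite: Bombieri2000Weil, Thm 8] -/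
theorem not_realNegIndexAtLeast_three_of_encard_le_one (h : Set.encard 𝒬 ≤ 1) (a : ℝ) :
    ¬ RealNegIndexAtLeast 3 a := by
  apply not_realNegIndexAtLeast_succ_of_two_mul_encard_le
  calc 2 * Set.encard 𝒬 ≤ 2 * 1 := by gcongr
    _ = ((2 : ℕ) : ℕ∞) := by norm_num

/-- **The third real level is STRICTLY WEAKER than RH, witnessed**: with EXACTLY one off-line quadruple the third
level of the full real form is clean at every window, while RH fails and the SECOND real level goes negative on some
window (M2 `realNegIndexAtLeast_two_of_not_riemannHypothesis`).  So `cand`-type invariants reading the third full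
level cannot separate `K = 1` from `K = 0`. [cite: Bombieri2000Weil, Thm 8] -/
theorem realThird_clean_of_card_eq_one (hfin : Set.Finite 𝒬) (hK : hfin.toFinset.card = 1) :
    (∀ a : ℝ, ¬ RealNegIndexAtLeast 3 a) ∧ ¬ RiemannHypothesis ∧ ∃ a : ℝ, RealNegIndexAtLeast 2 a := by
  obtain ⟨ρ, hρ⟩ := Finset.card_pos.1 (by omega : 0 < hfin.toFinset.card)
  rw [Set.Finite.mem_toFinset] at hρ
  have hRH : ¬ RiemannHypothesis := not_riemannHypothesis_of_mem_quadrant hρ.1 hρ.2.1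
  obtain ⟨A, hA⟩ := realNegIndexAtLeast_two_of_not_riemannHypothesis hRH
  exact ⟨(not_realNegIndexAtLeast_three_iff hfin).2 hK.le, hRH, A, hA A le_rfl⟩

/-- Under finiteness, `¬RH ↔ 1 ≤ K`. [folklore] -/
theorem not_riemannHypothesis_iff_one_le_card (hfin : Set.Finite 𝒬) :
    ¬ RiemannHypothesis ↔ 1 ≤ hfin.toFinset.card := by
  constructor
  · intro hRH
    have h := one_le_encard_quadrant_of_not_riemannHypothesis hRH
    rw [hfin.encard_eq_coe_toFinset_card] at h
    exact_mod_cast h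
  · intro hK
    obtain ⟨ρ, hρ⟩ := Finset.card_pos.1 (by omega : 0 < hfin.toFinset.card)
    rw [Set.Finite.mem_toFinset] at hρ
    exact not_riemannHypothesis_of_mem_quadrant hρ.1 hρ.2.1

/-- **General level, unconditional sandwich** (`K < ∞`): if no window carries `n + 1` independent real negative
directions then `K = 0` (i.e. RH) or `K + 1 ≤ n`; and (`not_realNegIndexAtLeast_succ_of_two_mul_encard_le`)
`2K ≤ n` suffices.  The exact threshold `2K ≤ n` needs the odd "≥" half (`OddIndexLowerHalf` below); for `n = 2`
the two bounds meet (`not_realNegIndexAtLeast_three_iff`). [cite: Bombieri2000Weil, Thm 8] -/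
theorem card_eq_zero_or_succ_le_of_not_realNegIndexAtLeast_succ (hfin : Set.Finite 𝒬) (n : ℕ)
    (hno : ∀ a : ℝ, ¬ RealNegIndexAtLeast (n + 1) a) :
    hfin.toFinset.card = 0 ∨ hfin.toFinset.card + 1 ≤ n := by
  by_cases hK : hfin.toFinset.card = 0
  · exact Or.inl hK
  · right
    by_contra hlt
    obtain ⟨A, hA⟩ := realNegIndexAtLeast_succ_of_finite hfin (by omega) (n := n) (by omega)
    exact hno A (hA A le_rfl)

/-- HYPOTHESIS binder (typed; the odd "≥" half — discharged in part 4 of this seat; its shape is Bombieri 2000,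
Thm 9, odd part, there for truncations): with finitely many quadrant zeros, every `n ≤ K` is attained as negative
ODD index on all long windows.  (A `Prop`: statement only, used as an explicit hypothesis below; a problem-side
binder, not a Literature fact.) -/
def OddIndexLowerHalf : Prop :=
  ∀ hfin : Set.Finite 𝒬, ∀ n : ℕ, n ≤ hfin.toFinset.card → ∃ A : ℝ, ∀ a : ℝ, A ≤ a → OddNegIndexAtLeast n a

/-- CONDITIONAL on `OddIndexLowerHalf`: the negative index of the full real Weil form on long windows is EXACTLY
`2K` — `(∃ a, RealNegIndexAtLeast n a) ↔ n ≤ 2K` (`K < ∞`). [cite: Bombieri2000Weil, Thm 8] -/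
theorem exists_realNegIndexAtLeast_iff_of_oddLowerHalf (hodd : OddIndexLowerHalf) (hfin : Set.Finite 𝒬)
    (n : ℕ) : (∃ a : ℝ, RealNegIndexAtLeast n a) ↔ n ≤ 2 * hfin.toFinset.card := by
  constructor
  · rintro ⟨a, ha⟩
    have h := le_two_mul_encard_quadrant_of_realNegIndexAtLeast ha
    rw [hfin.encard_eq_coe_toFinset_card] at h
    exact_mod_cast h
  · intro hn
    -- write `n = m + k` with `m, k ≤ K`
    obtain ⟨m, k, hm, hk, rfl⟩ : ∃ m k : ℕ, m ≤ hfin.toFinset.card ∧ k ≤ hfin.toFinset.card ∧ n = m + k :=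
      ⟨min n hfin.toFinset.card, n - min n hfin.toFinset.card, min_le_right _ _, by omega, by omega⟩
    obtain ⟨A₁, hA₁⟩ := evenNegIndexAtLeast_of_finite hfin hm
    obtain ⟨A₂, hA₂⟩ := hodd hfin k hk
    exact ⟨max A₁ A₂, realNegIndexAtLeast_add_of_even_odd (hA₁ _ (le_max_left _ _)) (hA₂ _ (le_max_right _ _))⟩

/-- CONDITIONAL on `OddIndexLowerHalf`: the full real-form level hierarchy is EXACTLY `2K ≤ n` — "no window carries
`n + 1` independent real negative directions" `↔ 2K ≤ n` (`K < ∞`); only `n = 0, 1` are RH-strength.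
[cite: Bombieri2000Weil, Thm 8] -/
theorem not_realNegIndexAtLeast_succ_iff_of_oddLowerHalf (hodd : OddIndexLowerHalf) (hfin : Set.Finite 𝒬)
    (n : ℕ) : (∀ a : ℝ, ¬ RealNegIndexAtLeast (n + 1) a) ↔ 2 * hfin.toFinset.card ≤ n := by
  have h := exists_realNegIndexAtLeast_iff_of_oddLowerHalf hodd hfin (n + 1)
  constructor
  · intro hno
    by_contra hlt
    obtain ⟨a, ha⟩ := h.2 (by omega)
    exact hno a ha
  · intro hle a ha
    have h2 := h.1 ⟨a, ha⟩
    omega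

end Summit.RiemannHypothesis.RiemannHypothesis.Theorems.PfPersistenceParityIndex

end
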